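import Summits.BirchSwinnertonDyer.BirchSwinnertonDyer.Theses.ResidualThetaTransportAtTwo
import Summits.BirchSwinnertonDyer.BirchSwinnertonDyer.Theorems.ResidualThetaTransportAtTwoAwayDefs
import Summits.BirchSwinnertonDyer.BirchSwinnertonDyer.Theorems.ResidualThetaTransportAtTwoResidualSignedLambdaLowerCMAtTwoDeepHalfAwayTwoAssemblyOfPins
import Summits.BirchSwinnertonDyer.BirchSwinnertonDyer.Theorems.ResidualThetaTransportAtTwoResidualSignedLambdaLowerCMAtTwoDeepHalfAwayTwoTowerPowTwo
import Summits.BirchSwinnertonDyer.BirchSwinnertonDyer.Theorems.ResidualThetaTransportAtTwoResidualSignedLambdaLowerCMAtTwoDeepHalfAwayTwoTowerCores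
import Summits.BirchSwinnertonDyer.BirchSwinnertonDyer.Theorems.ResidualThetaTransportAtTwoResidualSignedLambdaLowerCMAtTwoStubDeepHalfAtTwoStrictPins
import Literature.NumberTheory.EllipticCurves.Kato2004.IwasawaCohomologyCoeffNewform
import Literature.NumberTheory.EllipticCurves.Kato2004.UniversalNormsCoeffFramed
import HarnessLib

/-!
# S4₀ `stub_deepHalfAwayTwo` of line `onepair` — the registered text BY NAME

Route `ResidualThetaTransportAtTwo` (RTT), crux RSL_g `ResidualSignedLambdaLowerCMAtTwo` (stmt-BirchSwinnertonDyer-22608), line «onepair», skeleton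
v3b/v3d (`Cruxes/ResidualSignedLambdaLowerCMAtTwo/Lines/onepair.lean`; the S4₀ text is identical in v3b and v3d, 3201 chars), split stub **S4₀
`stub_deepHalfAwayTwo`** (lane of seat `prover-bsd-wall-tp2-p2x`, g19; `--supports`, closes nothing by itself). THEOREMS ONLY (no definition, no named
fact, no instance, no `sorry`). BSD is not proved by any of this; RSL_g (22608) and K3 (20308) stay OPEN.

**`stub_deepHalfAwayTwo`** (Poitou–Tate deep half AWAY from `2`, i.e. at the finite set `S₀ ∌ 2`): for every datum of RSL_g, every pin bundle `π` with
compatible roots `ζ_{k+1}² = ζ_k` and every `πₐ : AwayPins π`, a character family `χ : PAway` (one character of `D_w = H¹(ℚ_{∞,w}, A_ρ)` per `w ∈ S₀` and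
coset `c ∈ Γ ⧸ Γ_{n_w}`) killing the `S₀`-localisations of the relaxed Selmer classes that die at `v ∣ 2` (hypothesis (H₀)) IS `locd_S x` for some
`x ∈ 𝐇¹_Γ(T_ρ)` — with `a = 1`.

PROOF (all pieces landed as helpers on 22608): `AwayAssembly.exists_iwasawaH1_locdS_eq_of_towerCompat_floor` (p704576 + floor addendum: (H₀) ⟹ character
readback p701888 ⟹ levelwise orthogonality p703289 ⟹ prescribed Iwasawa class p697362 ⟹ pin transfer p702990), whose two tower hypotheses are
discharged by `AwayTowerPow.cohomologyMap_coindPow_eq_of_characters` ((T1), `[2]`-direction: the mixed projection formula `⟨[2]_* b', y⟩_k·2^{-k} =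
⟨b', ι_* y⟩_{k+1}·2^{-(k+1)}` from the root compatibility `hζ2` via `OnePairPins.ePk_tower_of_zeta_sq`) and `AwayTowerCores.cohomologyMap_coindSum_eq_of_characters`
((T2), trace direction, from the splitting level `n_w` on: the projection formula `⟨cor b', y⟩_n = ⟨b', res y⟩_{n+1}` and the fibre correspondence of the
Mackey frame `CosetFrame.bijective_cosets_out`).

References: [MilneADT2006] Ch. I Thm. 4.10; [PerrinRiou1994Invent] §3.6.1; [Kato2004Asterisque] §12.2 (p. 220), §13.8 (pp. 228–229), §17.13;
[NeukirchSchmidtWingberg2008] I §5 (1.5.6)–(1.5.7), I §6 (1.6.4); [GreenbergVatsal2000] §2 Prop. 2.4; [Kobayashi2003] (8.23).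
-/

set_option autoImplicit false
-- the Theorems namespace of this sub repeats the summit name by design (D-0017 nested layout)
set_option linter.dupNamespace false

noncomputable section

open scoped Classical

namespace Summit.BirchSwinnertonDyer.BirchSwinnertonDyer.Theorems.OnePair

open CategoryTheory Field NumberField IsDedekindDomain WeierstrassCurve
  Literature.NumberTheory.EllipticCurves Literature.NumberTheory.GaloisRepresentations
  Literature.NumberTheory.EllipticCurves.GreenbergSelmer Literature.NumberTheory.EllipticCurves.CyclotomicLayer
  Literature.NumberTheory.EllipticCurves.Kato2004
  Summit.BirchSwinnertonDyer.BirchSwinnertonDyer.Theorems.ThetaTransport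

set_option maxHeartbeats 1600000 in
/-- **S4₀ `stub_deepHalfAwayTwo` (registered text, v3b = v3d)** (Poitou–Tate deep half away from `2`): for every datum of RSL_g, every pin bundle `π` with
compatible roots `ζ_{k+1}² = ζ_k`, every `πₐ : AwayPins π`, a character family `χ : PAway` satisfying (H₀) is `locd_S x` for some `x ∈ 𝐇¹_Γ(T_ρ)` (`a = 1`).
[cite: MilneADT2006, Ch. I, Thm. 4.10] [cite: PerrinRiou1994Invent, §3.6.1] [cite: Kato2004Asterisque, §13.8 (pp. 228–229)]
[cite: NeukirchSchmidtWingberg2008, I §6 (1.6.4)] -/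
theorem stub_deepHalfAwayTwo :
    open Literature.NumberTheory.EllipticCurves GreenbergSelmer GreenbergVatsal2000 Kobayashi2003 ModularForms Rank1Residual Literature.NumberTheory.GaloisRepresentations Literature.NumberTheory.Automorphic IsDedekindDomain NumberField Field Rat.HeightOneSpectrum PowerSeries Summit.BirchSwinnertonDyer.BirchSwinnertonDyer.Theorems.OnePair in ∀ (W : WeierstrassCurve ℚ) [W.IsElliptic] [W.IsGloballyMinimal], GoodSS W 2 → W.frobeniusTrace 2 = 0 → W.Δ < 0 → ∀ (M : ℕ) [NeZero M] (g : CuspForm (CongruenceSubgroup.Gamma0 M) 2) (ι : coeffField g →+* PadicAlgCl 2), Odd M → IsNewform0 g → IsCMForm (liftToGamma1 M 2 g) → cuspCoeff g 2 = 0 → (∀ ℓ : ℕ, ℓ.Prime → ¬ ℓ ∣ 2 * M * W.conductorNorm ℤ → ‖embCoeff g ι ℓ - (W.frobeniusTrace ℓ : PadicAlgCl 2)‖ < 1) → ∀ (κ : ZpExtension ℚ 2) (γ : absoluteGaloisGroup ℚ), κ.IsCyclotomic → κ.IsTopGenerator γ → IsCyclotomicVariable 2 γ → ∀ (S₀ :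 Finset (HeightOneSpectrum (RingOfIntegers ℚ))), (∀ v ∈ S₀, ((2 : ℕ) : RingOfIntegers ℚ) ∉ v.asIdeal) → (∀ v, ¬ W.HasGoodReductionAt v → v ∈ S₀) → (∀ v, natGenerator v ∣ M → v ∈ S₀) → ∀ (n : ℕ) (ρ : FramedGaloisRep ℚ (coeffO (Set.range ι)) 2) (Θ : ∀ v : HeightOneSpectrum (RingOfIntegers ℚ), ((2 : ℕ) : RingOfIntegers ℚ) ∈ v.asIdeal → (CofreeF (Set.range ι) ρ ≃+ (Fin n → ↥(W.geomPrimaryTorsion 2)))), (∀ v, ¬ natGenerator v ∣ 2 * M → ρ.IsUnramifiedAt v ∧ ∃ P : Polynomial (coeffO (Set.range ι)), P.map (padicCoeffIntegers (Set.range ι)).subtype = Polynomial.X ^ 2 - Polynomial.C (embCoeff g ι (natGenerator v)) * Polynomial.X + Polynomial.C ((natGenerator v : ℕ) : PadicAlgCl 2) ∧ ρ.HasFrobCharpolyAt v P) → ∀ (hΘ : ∀ v hv (δ : absoluteGaloisGroup (v.adicCompletion ℚ)) m i, Θ v hv (resGalOfEmb (closureEmb (K := ℚ) (v.adicCompletion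 ℚ)) δ • m) i = resGalOfEmb (closureEmb (K := ℚ) (v.adicCompletion ℚ)) δ • Θ v hv m i), ∀ (ϖ : (coeffO (Set.range ι))), Irreducible ϖ → ∀ (Sg : AddSubgroup (H1Γ (Set.range ι) κ ρ)) [Module (coeffO (Set.range ι)) ↥Sg], (∀ (a : (coeffO (Set.range ι))) (s : ↥Sg), ((a • s : ↥Sg) : H1Γ (Set.range ι) κ ρ) = scalarH1 κ.kerSubgroup (CofreeF (Set.range ι) ρ) a s) → (∀ y : H1Γ (Set.range ι) κ ρ, y ∈ Sg ↔ y ∈ plusSelmerSet (Set.range ι) W κ S₀ n ρ Θ) → (∀ (τ : absoluteGaloisGroup ℚ) (y : H1Γ (Set.range ι) κ ρ), y ∈ Sg → conjH1 κ.kerSubgroup (CofreeF (Set.range ι) ρ) τ y ∈ Sg) → (plusSelmerTorsionSet (Set.range ι) W κ S₀ n ρ Θ ϖ).Finite → ∀ (I : Kato2004.IwasawaH1DataCoeff (FramedGaloisRep.toGaloisRep ρ) 2 κ γ) [Module (coeffO (Set.range ι)) I.H] [IsScalarTower (coeffO (Set.range ι)) (IwasawaAlgebraO (Set.range ι)) I.H],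 (∀ (a : (coeffO (Set.range ι))) (x : I.H), a • x = (PowerSeries.C a : IwasawaAlgebraO (Set.range ι)) • x) → ∀ (π : OnePairPins (Set.range ι) W κ γ S₀ n ρ Θ hΘ I Sg) (hζ2 : ∀ k : ℕ, π.ζ (k + 1) ^ 2 = π.ζ k), ∀ [∀ w : ↥S₀, Module ℤ_[2] (Dloc (Set.range ι) κ ρ (w : HeightOneSpectrum (RingOfIntegers ℚ)))] (πₐ : AwayPins (Set.range ι) κ ρ S₀ W γ n Θ hΘ I Sg π), ∀ χ : PAway (Set.range ι) κ ρ S₀, (∀ s : H1Γ (Set.range ι) κ ρ, s ∈ selRelSubgroup (Set.range ι) κ ρ S₀ → locKer (Set.range ι) κ ρ π.v s = 0 → ∑ w : ↥S₀, ∑ᶠ c : Cosets κ (w : HeightOneSpectrum (RingOfIntegers ℚ)), χ w c (locAway (Set.range ι) κ ρ S₀ s w c) = 0) → ∃ a : ℤ_[2], a ≠ 0 ∧ ∃ x : I.H, a • χ = πₐ.locdS x := by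
  intro W _ _ hss ha2 hΔ M _ g ι hodd hnew hcm hcusp hcong κ γ hκ hγ hcyc S₀ hS₀2 hbad hMS₀ n ρ Θ hρ hΘ ϖ hϖ Sg _ hsmul hSg hconj hfin
    I _ _ hIsmul π hζ2 _ πₐ χ hH
  haveI : FiniteDimensional ℚ (ModularForms.coeffField g) := ModularForms.IsNewform0.finiteDimensional_coeffField_holds hnew
  haveI : CompactSpace (coeffO (Set.range ι)) := OnePairPins.compactSpace_coeffO_of_finiteDimensional ι
  haveI : CompactSpace (absoluteGaloisGroup ℚ) := absoluteGaloisGroup_compactSpace ℚ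
  haveI hcw : ∀ w : HeightOneSpectrum (𝓞 ℚ), CompactSpace (absoluteGaloisGroup (w.adicCompletion ℚ)) := fun w =>
    absoluteGaloisGroup_compactSpace _
  haveI hfi : ∀ m : ℕ, (κ.layerSubgroup m).FiniteIndex := fun m =>
    finiteIndex_of_isOpen_of_compactSpace _ (κ.isOpen_layerSubgroup m)
  letI hft : ∀ m : ℕ, Fintype (absoluteGaloisGroup ℚ ⧸ κ.layerSubgroup m) := fun m => Fintype.ofFinite _
  haveI hfin' : ∀ k : ℕ, Finite ↥(AddSubgroup.torsionBy (Cofree ρ ↥(padicCoeffField (Set.range ι))) ((2 ^ k : ℕ) : ℤ)) := fun k =>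
    UniversalNorms.finite_cofreeTorsionBy_of_compactSpace (Set.range ι) ρ k
  obtain ⟨x, hx⟩ := AwayAssembly.exists_iwasawaH1_locdS_eq_of_towerCompat_floor (Set.range ι) ρ π.ePk π.hμPk π.hadd₁Pk π.hadd₂Pk
    π.hgalPk π.ePk_nondegenerate κ hκ S₀ hS₀2 (OnePairPins.isUnramifiedAt_of_habitat (ρ := ρ) (fun v hv ↦ (hρ v hv).1) hMS₀) I π.v π.hv χ hH
    πₐ.locdS πₐ.hlocdS
    (fun m k w hm b₁ t₁ b₀ t₀ hb₁ hu₁ hb₀ hu₀ =>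
      AwayTowerPow.cohomologyMap_coindPow_eq_of_characters (Set.range ι) ρ π.ePk π.hμPk π.hadd₁Pk π.hadd₂Pk π.hgalPk π.ePk_nondegenerate
        (π.ePk_tower_of_zeta_sq hζ2) κ hκ (w : HeightOneSpectrum (𝓞 ℚ)) (hS₀2 w w.2) m k (χ w) b₁ t₁ b₀ t₀ hb₁ hu₁ hb₀ hu₀)
    (fun m k w hm b₁ t₁ b₀ t₀ hb₁ hu₁ hb₀ hu₀ =>
      AwayTowerCores.cohomologyMap_coindSum_eq_of_characters (Set.range ι) ρ π.ePk π.hμPk π.hadd₁Pk π.hadd₂Pk π.hgalPk π.ePk_nondegenerate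
        κ hκ (w : HeightOneSpectrum (𝓞 ℚ)) (hS₀2 w w.2) hm k (χ w) b₁ t₁ b₀ t₀ hb₁ hu₁ hb₀ hu₀)
  exact ⟨1, one_ne_zero, x, by rw [one_smul, hx]⟩

end Summit.BirchSwinnertonDyer.BirchSwinnertonDyer.Theorems.OnePair

end
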